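import Mathlib
import HarnessLib
import Summits.HubbardSuperconductivity.HubbardSuperconductivity.Theorems.KLProgrammeC4aCooperLevelFloor
import Summits.HubbardSuperconductivity.HubbardSuperconductivity.Theorems.KLProgrammeC4aBandDistanceControlTransversal
import Summits.HubbardSuperconductivity.HubbardSuperconductivity.Theorems.KLProgrammeC4aCausticWindowCover

/-!
# Route `KLProgramme` — crux C4a, S3 brick (B4) «(U1)-HYBRID» part D-3c (iii): THE RATIO-FORM KEY LEMMA NEAR COOPER AT `e = ρ = 0` —
# `|𝒜_φ(0,φ;0,ϑ,θ)| ≤ Q·|ē(0,φ;0,ϑ,θ)|` on the whole loop circle, for `|ϑ − π| ≤ η₀`, with `Q` FREE OF `η = ϑ − π`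

Cell `gate-hubbard-kl`, seat hubbard-kl-k3c3-p3 (g37; row «implicit-function / monotonicity route for μ(n)»).  Located brick for the (C)-closer lane / the (M4)
assembly of the first-order ϑ-layer (stub (C) `stub_twoLeg_curvature` of `KLRegimeEngineV17F2`, stmt-HubbardSuperconductivity-20437), memo
HOME/hubbard-kl-k3c3-p3/U1-CAUSTIC-SUP.md §19 addendum (c) «D-3: the near-(C) ratio-form key lemma».

THE ASSEMBLY.  `…C4aBandDistanceControlTransversal.abs_iteratedDeriv_partnerBand_pp_base_le_mul_abs_of_ceilings` (transversal two-zero control at `m = 1` on the loop-angle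
set `S = [−π/2, 3π/2]`, zeros `0` and `ϑ`) with the η-SCALED data of parts (i)/(ii): slopes `σ = (G/2)|η|` on the fixed radius `δ₀` (`…C4aCooperProfileRows`), floor
`κ = (Gδ₀/4)|η|` (`…C4aCooperLevelFloor`), ceilings `H₁ = H₁₀|η|`, `H₀ = H₀₀|η|` with `H₁₀ = K₂msD₁msD₂ + (K₃msD₁² + K₂msD₂)msD₁`, `H₀₀ = K₁msD₂ + K₂msD₁²`; the factor `|η|`
CANCELS in `max(H₁/σ, H₀/κ)`: `Q = max(H₁₀/(G/2), H₀₀/(Gδ₀/4))`.  At `η = 0` both sides vanish (`H₀` row).  The loop angle is then freed from the window by `2π`-periodicity.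
Thresholds (rows, jointly feasible — `exists_cooperKeyThresholds`): `0 < δ₀ ≤ π/2`, `(K₃msD₁² + K₂msD₂)msD₁·δ₀ ≤ G/2`, `0 ≤ η₀ ≤ δ₀/2`, `(K₁msD₂ + K₂msD₁²)·η₀ ≤ Gδ₀/4`.
* **`abs_baseDeriv_partnerBand_pp_le_mul_abs_cooper_zero`** (HEADLINE) — the ratio control at `e = ρ = 0` for every loop angle `φ ∈ ℝ`;
* `exists_cooperKeyThresholds` — feasibility of the threshold rows with `η₀ > 0`.
Sizes binder shape + clause (i) `GeomConstants` of `FrameOK`; pure calculus on landed objects; nothing asserts (C), K3 or superconductivity.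
References: FST II CPAM 51 (1998) §3 Thm 3.5 [cite: FeldmanSalmhoferTrubowitz1998]; BGM 2003 §7.1 Lemma 7.1 (A1.9) [cite: BenfattoGiulianiMastropietro2003];
BGM 2006 §2.4 Lemma 2.1 (2.40) [cite: BenfattoGiulianiMastropietro2006].
-/

noncomputable section

namespace Summit.HubbardSuperconductivity.HubbardSuperconductivity.Theorems.C4a

set_option linter.dupNamespace false -- summit = problem name (single-conjunct summit), D-0017

open Real Set Filter
open scoped Topology
open Literature.MathematicalPhysics.QuantumLattice Literature.MathematicalPhysics.QuantumLattice.BandSectorCounting Literature.Probability.LatticeModels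
open Literature.MathematicalPhysics.QuantumLattice.FermiRG
open Summit.HubbardSuperconductivity.HubbardSuperconductivity.Theorems.KLRegimeSplit
open Summit.HubbardSuperconductivity.HubbardSuperconductivity.Theorems.DispersionFlow
open Summit.HubbardSuperconductivity.HubbardSuperconductivity.Theorems.PerturbedFermiCurve

/-- **Feasibility of the Cooper key-lemma thresholds**: for `G > 0` and `M, H ≥ 0` there are `δ₀, η₀ > 0` with `δ₀ ≤ π/2`, `M·δ₀ ≤ G/2`, `η₀ ≤ δ₀/2`, `H·η₀ ≤ Gδ₀/4`. -/
theorem exists_cooperKeyThresholds {G M H : ℝ} (hG : 0 < G) (hM : 0 ≤ M) (hH : 0 ≤ H) :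
    ∃ δ₀ η₀ : ℝ, 0 < δ₀ ∧ δ₀ ≤ π / 2 ∧ M * δ₀ ≤ G / 2 ∧ 0 < η₀ ∧ η₀ ≤ δ₀ / 2 ∧ H * η₀ ≤ G * δ₀ / 4 := by
  have hπ := Real.pi_pos
  set δ₀ : ℝ := min (π / 2) (G / 2 / (M + 1)) with hδ₀
  have hδ₀0 : 0 < δ₀ := lt_min (by positivity) (by positivity)
  refine ⟨δ₀, min (δ₀ / 2) (G * δ₀ / 4 / (H + 1)), hδ₀0, min_le_left _ _, ?_, lt_min (by positivity) (by positivity), min_le_left _ _, ?_⟩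
  · calc M * δ₀ ≤ M * (G / 2 / (M + 1)) := mul_le_mul_of_nonneg_left (min_le_right _ _) hM
      _ = G / 2 * (M / (M + 1)) := by ring
      _ ≤ G / 2 * 1 := mul_le_mul_of_nonneg_left ((div_le_one (by positivity)).2 (by linarith)) (by positivity)
      _ = G / 2 := mul_one _
  · calc H * min (δ₀ / 2) (G * δ₀ / 4 / (H + 1)) ≤ H * (G * δ₀ / 4 / (H + 1)) := mul_le_mul_of_nonneg_left (min_le_right _ _) hH
      _ = G * δ₀ / 4 * (H / (H + 1)) := by ring
      _ ≤ G * δ₀ / 4 * 1 := mul_le_mul_of_nonneg_left ((div_le_one (by positivity)).2 (by linarith)) (by positivity)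
      _ = G * δ₀ / 4 := mul_one _

section Sizes

variable {K : TrigPolyC4v} {A : ℝ} (hA : ∀ p : Momentum, ∀ j ≤ 2, ‖iteratedFDeriv ℝ j (frameShift K) p‖ ≤ A) (hA20 : A ≤ 1 / 20)
  (hd : klCurveD ≤ (bandBounds (show (-4 : ℝ) < -1.1 by norm_num) (show (-1.1 : ℝ) ≤ -0.1 by norm_num)
    (show (-0.1 : ℝ) < 0 by norm_num)).Dtmin - 2 * A)
  {μ r : ℝ} (hr : 0 < r) (hlo : (-1.1 : ℝ) < μ - r - A) (hhi : μ + r + A < -0.1)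
  {A₃ A₄ : ℝ} (hA₃ : ∀ p : Momentum, ‖iteratedFDeriv ℝ 3 (frameShift K) p‖ ≤ A₃)
  (hA₄ : ∀ p : Momentum, ‖iteratedFDeriv ℝ 4 (frameShift K) p‖ ≤ A₄)
  {K₁ K₂ K₃ : ℝ} (hK₁ : ∀ p : Momentum, ‖fderiv ℝ (frameLevel μ K) p‖ ≤ K₁) (hK₂ : ∀ p : Momentum, ‖iteratedFDeriv ℝ 2 (frameLevel μ K) p‖ ≤ K₂)
  (hK₃ : ∀ p : Momentum, ‖iteratedFDeriv ℝ 3 (frameLevel μ K) p‖ ≤ K₃)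
include hA hA20 hd hr hlo hhi hA₃ hA₄ hK₁ hK₂ hK₃

/-- **THE RATIO-FORM KEY LEMMA NEAR COOPER AT `e = ρ = 0`** (HEADLINE; see the module docstring): under clause (i) of `FrameOK` and the threshold rows, for
`|ϑ − π| ≤ η₀` and EVERY loop angle `φ`,
`|∂_ψ|_θ e_K(Φ(0,ψ) + Φ(0,ϑ+ψ) − Φ(0,φ+ψ))| ≤ max(H₁₀/(G/2), H₀₀/(Gδ₀/4))·|e_K(Φ(0,θ) + Φ(0,ϑ+θ) − Φ(0,φ+θ))|`. [cite: BenfattoGiulianiMastropietro2006, §2.4 Lemma 2.1] -/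
theorem abs_baseDeriv_partnerBand_pp_le_mul_abs_cooper_zero {Kc r₀ g₀ w : ℝ} (hG : GeomConstants (frameLevel μ K) Kc r₀ g₀ w) {δ₀ η₀ : ℝ}
    (hδ₀ : 0 < δ₀) (hδ₀π : δ₀ ≤ π / 2)
    (hδrow : (K₃ * msD A₃ A₄ 1 ^ 2 + K₂ * msD A₃ A₄ 2) * msD A₃ A₄ 1 * δ₀ ≤
      (2 / π * (((bandBounds (show (-4 : ℝ) < -1.1 by norm_num) (show (-1.1 : ℝ) ≤ -0.1 by norm_num) (show (-0.1 : ℝ) < 0 by norm_num)).Dtmin - 2 * A) *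
        (bandBounds (show (-4 : ℝ) < -1.1 by norm_num) (show (-1.1 : ℝ) ≤ -0.1 by norm_num) (show (-0.1 : ℝ) < 0 by norm_num)).umin) *
        ((bandBounds (show (-4 : ℝ) < -1.1 by norm_num) (show (-1.1 : ℝ) ≤ -0.1 by norm_num) (show (-0.1 : ℝ) < 0 by norm_num)).umin * w / (4 + 2 * A))) / 2)
    (hη₀ : η₀ ≤ δ₀ / 2)
    (hη₀row : (K₁ * msD A₃ A₄ 2 + K₂ * msD A₃ A₄ 1 ^ 2) * η₀ ≤
      (2 / π * (((bandBounds (show (-4 : ℝ) < -1.1 by norm_num) (show (-1.1 : ℝ) ≤ -0.1 by norm_num) (show (-0.1 : ℝ) < 0 by norm_num)).Dtmin - 2 * A) *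
        (bandBounds (show (-4 : ℝ) < -1.1 by norm_num) (show (-1.1 : ℝ) ≤ -0.1 by norm_num) (show (-0.1 : ℝ) < 0 by norm_num)).umin) *
        ((bandBounds (show (-4 : ℝ) < -1.1 by norm_num) (show (-1.1 : ℝ) ≤ -0.1 by norm_num) (show (-0.1 : ℝ) < 0 by norm_num)).umin * w / (4 + 2 * A))) * δ₀ / 4)
    {ϑ : ℝ} (hϑ : |ϑ - π| ≤ η₀) (θ φ : ℝ) :
    |deriv (fun ψ : ℝ => frameLevel μ K (levelPoint μ K 0 ψ + levelPoint μ K 0 (ϑ + ψ) - levelPoint μ K 0 (φ + ψ))) θ| ≤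
      max ((K₂ * msD A₃ A₄ 1 * msD A₃ A₄ 2 + (K₃ * msD A₃ A₄ 1 ^ 2 + K₂ * msD A₃ A₄ 2) * msD A₃ A₄ 1) /
            ((2 / π * (((bandBounds (show (-4 : ℝ) < -1.1 by norm_num) (show (-1.1 : ℝ) ≤ -0.1 by norm_num) (show (-0.1 : ℝ) < 0 by norm_num)).Dtmin - 2 * A) *
              (bandBounds (show (-4 : ℝ) < -1.1 by norm_num) (show (-1.1 : ℝ) ≤ -0.1 by norm_num) (show (-0.1 : ℝ) < 0 by norm_num)).umin) *
              ((bandBounds (show (-4 : ℝ) < -1.1 by norm_num) (show (-1.1 : ℝ) ≤ -0.1 by norm_num) (show (-0.1 : ℝ) < 0 by norm_num)).umin * w / (4 + 2 * A))) / 2))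
          ((K₁ * msD A₃ A₄ 2 + K₂ * msD A₃ A₄ 1 * msD A₃ A₄ 1) /
            ((2 / π * (((bandBounds (show (-4 : ℝ) < -1.1 by norm_num) (show (-1.1 : ℝ) ≤ -0.1 by norm_num) (show (-0.1 : ℝ) < 0 by norm_num)).Dtmin - 2 * A) *
              (bandBounds (show (-4 : ℝ) < -1.1 by norm_num) (show (-1.1 : ℝ) ≤ -0.1 by norm_num) (show (-0.1 : ℝ) < 0 by norm_num)).umin) *
              ((bandBounds (show (-4 : ℝ) < -1.1 by norm_num) (show (-1.1 : ℝ) ≤ -0.1 by norm_num) (show (-0.1 : ℝ) < 0 by norm_num)).umin * w / (4 + 2 * A))) * δ₀ / 4)) *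
        |frameLevel μ K (levelPoint μ K 0 θ + levelPoint μ K 0 (ϑ + θ) - levelPoint μ K 0 (φ + θ))| := by
  set B := bandBounds (show (-4 : ℝ) < -1.1 by norm_num) (show (-1.1 : ℝ) ≤ -0.1 by norm_num) (show (-0.1 : ℝ) < 0 by norm_num) with hBdef
  set G : ℝ := 2 / π * ((B.Dtmin - 2 * A) * B.umin) * (B.umin * w / (4 + 2 * A)) with hGdef
  set H₁₀ : ℝ := K₂ * msD A₃ A₄ 1 * msD A₃ A₄ 2 + (K₃ * msD A₃ A₄ 1 ^ 2 + K₂ * msD A₃ A₄ 2) * msD A₃ A₄ 1 with hH₁₀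
  set H₀₀ : ℝ := K₁ * msD A₃ A₄ 2 + K₂ * msD A₃ A₄ 1 * msD A₃ A₄ 1 with hH₀₀
  have hπ := Real.pi_pos
  have h0 : |(0 : ℝ)| < r := by simpa using hr
  have hADt : 2 * A < B.Dtmin := by have := klCurveD_pos; linarith only [this, hd]
  have hDt : 0 < B.Dtmin - 2 * A := by linarith only [hADt]
  have hA0 : 0 ≤ A := le_trans (norm_nonneg _) (hA 0 0 (by norm_num))
  have hGpos : 0 < G :=
    mul_pos (mul_pos (by positivity) (mul_pos hDt B.umin_pos)) (by have := B.umin_pos; have := hG.wmin_pos; positivity)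
  have hK₁0 : 0 ≤ K₁ := (norm_nonneg _).trans (hK₁ 0)
  have hK₂0 : 0 ≤ K₂ := (norm_nonneg _).trans (hK₂ 0)
  have hK₃0 : 0 ≤ K₃ := (norm_nonneg _).trans (hK₃ 0)
  have hD1 : 0 ≤ msD A₃ A₄ 1 := (msD_one_pos A₃ A₄).le
  have hD2 : 0 ≤ msD A₃ A₄ 2 := (norm_nonneg _).trans (norm_iteratedDeriv_levelPoint_le hA hA20 hd hlo hhi hA₃ hA₄ h0 (i := 2) (by norm_num) (by norm_num) 0)
  have hH₀₀0 : 0 ≤ H₀₀ := by positivity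
  have hH₁₀0 : 0 ≤ H₁₀ := by positivity
  have hQ0 : 0 ≤ max (H₁₀ / (G / 2)) (H₀₀ / (G * δ₀ / 4)) := le_max_of_le_left (by positivity)
  have hη₀0 : 0 ≤ η₀ := (abs_nonneg _).trans hϑ
  have hϑπ : |ϑ - π| ≤ π / 2 := hϑ.trans (hη₀.trans (by linarith))
  -- §A periodic reduction of the loop angle to the window `[−π/2, 3π/2)`
  set φ' : ℝ := toIcoMod Real.two_pi_pos (-(π / 2)) φ with hφ'
  have hφ'I : φ' ∈ Icc (-(π / 2)) (3 * π / 2) := by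
    have h := toIcoMod_mem_Ico Real.two_pi_pos (-(π / 2)) φ
    exact ⟨h.1, by linarith [h.2]⟩
  obtain ⟨n, hn⟩ : ∃ n : ℤ, φ = φ' + n • (2 * π) :=
    ⟨toIcoDiv Real.two_pi_pos (-(π / 2)) φ, (toIcoMod_add_toIcoDiv_zsmul Real.two_pi_pos (-(π / 2)) φ).symm⟩
  have hper : ∀ ψ : ℝ, levelPoint μ K 0 (φ + ψ) = levelPoint μ K 0 (φ' + ψ) := fun ψ => by
    rw [hn, zsmul_eq_mul, show φ' + (n : ℝ) * (2 * π) + ψ = φ' + ψ + 2 * π * (n : ℝ) by ring, levelPoint_add_int_mul_two_pi]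
  have hfun : (fun ψ : ℝ => frameLevel μ K (levelPoint μ K 0 ψ + levelPoint μ K 0 (ϑ + ψ) - levelPoint μ K 0 (φ + ψ))) =
      fun ψ : ℝ => frameLevel μ K (levelPoint μ K 0 ψ + levelPoint μ K 0 (ϑ + ψ) - levelPoint μ K 0 (φ' + ψ)) := by
    funext ψ; rw [hper ψ]
  rw [hfun, hper θ]
  -- §B the case `η = 0`: both sides vanish
  by_cases hη : ϑ - π = 0
  · have h := abs_baseDeriv_partnerBand_pp_le_cooper_zero hA hA20 hd hr hlo hhi hA₃ hA₄ hK₁ hK₂ h0 ϑ θ φ'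
    rw [hη, abs_zero, mul_zero] at h
    exact h.trans (mul_nonneg hQ0 (abs_nonneg _))
  have hηpos : 0 < |ϑ - π| := abs_pos.2 hη
  -- §C the transversal two-zero control with η-scaled data
  have hS : pairSumPath μ K 0 ϑ θ 0 = levelPoint μ K 0 θ + levelPoint μ K 0 (ϑ + θ) := by simp only [pairSumPath, add_zero]
  obtain ⟨ε₁, hε₁, hσ₁⟩ := exists_sign_slope_row_at_k_cooper hA hA20 hd hr hlo hhi hA₃ hA₄ hK₂ hK₃ hG hϑπ θ hδrow
  obtain ⟨ε₂, hε₂, hσ₂⟩ := exists_sign_slope_row_at_q_cooper hA hA20 hd hr hlo hhi hA₃ hA₄ hK₂ hK₃ hG hϑπ θ hδrow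
  simp only [hS] at hσ₁ hσ₂
  have hfloor : ∀ t ∈ Icc (-(π / 2)) (3 * π / 2), δ₀ < |t - 0| → δ₀ < |t - ϑ| →
      G * δ₀ / 4 * |ϑ - π| ≤ |frameLevel μ K (levelPoint μ K 0 θ + levelPoint μ K 0 (ϑ + θ) - levelPoint μ K 0 (t + θ))| := by
    intro t ht ht0 htϑ
    have h := abs_partnerBand_pp_level_zero_ge_cooper hA hA20 hd hr hlo hhi hA₃ hA₄ hK₁ hK₂ hG hδ₀π hη₀ hη₀row hϑ θ ht ht0 htϑ
    rwa [hS] at h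
  have hH₁ : ∀ i ∈ ({0, ϑ} : Set ℝ), ∀ x ∈ Icc (i - δ₀) (i + δ₀), |deriv (fun φ : ℝ =>
      iteratedDeriv 1 (fun ψ : ℝ => frameLevel μ K (levelPoint μ K 0 ψ + levelPoint μ K 0 (ϑ + ψ) - levelPoint μ K 0 (φ + ψ))) θ) x| ≤ H₁₀ * |ϑ - π| := by
    intro _ _ x _
    simpa only [iteratedDeriv_one] using abs_deriv_baseDeriv_partnerBand_pp_le_cooper_zero hA hA20 hd hr hlo hhi hA₃ hA₄ hK₂ hK₃ h0 ϑ θ x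
  have hH₀' : ∀ t ∈ Icc (-(π / 2)) (3 * π / 2), δ₀ < |t - 0| → δ₀ < |t - ϑ| → |iteratedDeriv 1 (fun ψ : ℝ =>
      frameLevel μ K (levelPoint μ K 0 ψ + levelPoint μ K 0 (ϑ + ψ) - levelPoint μ K 0 (t + ψ))) θ| ≤ H₀₀ * |ϑ - π| := by
    intro t _ _ _
    simpa only [iteratedDeriv_one] using abs_baseDeriv_partnerBand_pp_le_cooper_zero hA hA20 hd hr hlo hhi hA₃ hA₄ hK₁ hK₂ h0 ϑ θ t
  have hctrl := abs_iteratedDeriv_partnerBand_pp_base_le_mul_abs_of_ceilings hA hd hr hlo hhi ϑ θ 1 (S := Icc (-(π / 2)) (3 * π / 2))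
    (σ := G / 2 * |ϑ - π|) (κ := G * δ₀ / 4 * |ϑ - π|) (H₀ := H₀₀ * |ϑ - π|) (H₁ := H₁₀ * |ϑ - π|)
    (by positivity) (by positivity) (by positivity) hδ₀.le hε₁ hε₂ hσ₁ hσ₂ hfloor hH₁ hH₀' hφ'I
  rw [iteratedDeriv_one] at hctrl
  have hQ : max (H₁₀ * |ϑ - π| / (G / 2 * |ϑ - π|)) (H₀₀ * |ϑ - π| / (G * δ₀ / 4 * |ϑ - π|)) = max (H₁₀ / (G / 2)) (H₀₀ / (G * δ₀ / 4)) := by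
    rw [mul_div_mul_right _ _ hηpos.ne', mul_div_mul_right _ _ hηpos.ne']
  rw [hQ] at hctrl
  exact hctrl

end Sizes

end Summit.HubbardSuperconductivity.HubbardSuperconductivity.Theorems.C4a

end
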